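/-
Copyright (c) 2026 the pub-hodgecm-mathlib formalisation cell (harness21).  Prover seat hodgecm-mathlib-K2E1-p11 (g0), Track B ∕ K2-LIT,
h413 = `stmt-HodgeConjecture-24833`, line `K2_E1_TraceFormulaBeta`, campaign «EIS-WHITTAKER-3» rung J4₃ of the dealer K2E1-plan (g5) 2026-09-04T08:12:57Z
(«hypothesis-first DOUBLE-SUM ENGINE» for the Fourier–Jacobi layer; WIRING TABLE (γ) `WIRING-W5-FINAL-EisWhittaker3.K2E1b-plan-g6.md` §1 row J4₃).
-/
import Summits.HodgeConjecture.HodgeConjecture.Theorems.K2E1WhittakerSeriesConvergenceU2   -- ★ W4 (generic `K`): §1 `exists_exp_neg_mul_rpow_le_rpow_neg`, §3 Weierstrass, §4 `summable_majorant_ratPoints`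
import Mathlib.NumberTheory.NumberField.InfiniteAdeleRing                                   -- Mathlib: `InfiniteAdeleRing.mixedEmbedding_eq_algebraMap_comp`
import Mathlib.NumberTheory.NumberField.InfinitePlace.Ramification                            -- Mathlib: `InfinitePlace.comap_apply`
import Mathlib.Topology.Algebra.InfiniteSum.Real                                              -- Mathlib: `summable_prod_of_nonneg`
import HarnessLib

/-!
# K2·E1 — `K2E1FourierJacobiSeriesConvergenceU3`: THE FOURIER–JACOBI LAYER `Σ_{x₀ ∈ E} Σ_{η ∈ Fˣ} J(z, x₀, η)` OF `E − E_B` ON `U(2,1)_{E∕F}` CONVERGES LOCALLY NORMALLY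
# AND IS HOLOMORPHIC IN `z` (campaign «EIS-WHITTAKER-3», rung J4₃: the TWO-INDEX ADELIC LATTICE M-TEST — ★ W4 over `K := E` after a dilation, then ★ W4 over `K := F`)

Track B ∕ K2-LIT, crux h413 = `stmt-HodgeConjecture-24833`, route of record `HCCMUnconditional`; cell `hodgecm-mathlib`, squad K2, ENGINE E1.  Prover seat `hodgecm-mathlib-K2E1-p11` (g0);
rung J4₃ of the dealer K2E1-plan (g5) (08:12:57Z), REPORT-FIRST 08:17:49Z.  THEOREMS ONLY (no `def`, no `instance`, no notation, no named-fact hypothesis, no `sorry`; default heartbeats);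
lane `--supports stmt-HodgeConjecture-24833 --as helper` (count-neutral).  Closes no socket.  GENERIC number fields `F ⊂ E` (`[Algebra F E]`; the campaign's `F = L⁺`, `E = L`); no CM input.

THE MATHEMATICS [MoeglinWaldspurger1995, I.2.10 and II.1.7; Garrett2018, §1.9–§1.10 and §2.8; GelbartPS1984, §2; WeilBNT1967, Ch. IV §2].  In the currency of ★ W1₃
`K2E1EisensteinMinusConstantTermPoissonU3.eisensteinSeriesU_sub_borelConstantTerm_eq_three` the FOURIER–JACOBI LAYER of `E − E_B` on `U(J₃)` is the ITERATED lattice sum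
`μ_F(D_F)⁻¹ · Σ'_{x₀ ∈ E} Σ'_{η ∈ F} 𝟙_{η ≠ 0} · 𝓕_F[Φ_g(x₀, ·)](η)` over the rational Heisenberg quotient `(x₀, η) ∈ E × Fˣ` (`x₀` the `N∕Z`-coordinate, `η` the central frequency).
J3₃ ∕ J-hJbd₃ identify and bound its terms; locally uniformly in `z` (after the sibling file `…U3Coupled` converts the per-place Gaussian currency `exp(−b·Σ_{w∣∞}|η|_w(1+|x₀|_w²))`)
`‖J(z, x₀, η)‖ ≤ M·e^{−b‖η_∞‖}·(1+‖η_∞‖)^a·(1+‖x₀,∞‖)^{−k}` (`k > [E:ℚ]`, sup norms of `mixedEmbedding`) with the JOINT SUPPORT `J = 0` unless `η_f ∈ C_F` (compact `⊂ 𝔸_{F,f}`) and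
`(η·x₀)_f ∈ C_E` (compact `⊂ 𝔸_{E,f}`) — W0₃ CONVENTIONS §6 «jointly `|η|_v·max(1,‖x₀‖_w) ≤ λ_v`»: for fixed `η` the admissible `x₀` run over the DILATED lattice `η⁻¹·(E ∩ C_E)`.
This file turns such NAMED bounds into the convergence∕holomorphy letters W5₃-FINAL needs (`hsumF`-type, `hsumA`, holomorphy of the iterated sum):
§1 (generic `K`) **`exists_forall_tsum_rpow_neg_dilate_le`** — the DILATION LEMMA: for `k > [K:ℚ]` and `C ⊂ 𝔸_{K,f}` compact there is ONE `B` with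
`Σ_{y ∈ K, (a·y)_f ∈ C} (1+‖y_∞‖)^{−k} ≤ B·max(1, ‖a_∞‖)^k` for EVERY `a ∈ Kˣ` (reindex `y' = a·y`; submultiplicativity of the sup norm on `K_∞ = ℝ^{r₁} × ℂ^{r₂}` gives
`(1+‖a⁻¹y'‖)^{−k} ≤ max(1,‖a_∞‖)^k·(1+‖y'_∞‖)^{−k}`; then ★ W4 `summable_majorant_ratPoints`).
§2 (`F ⊂ E`) **`summable_twoIndexMajorant`** — `u(x₀, η) := 𝟙_{η≠0}·M e^{−b‖η_∞‖}(1+‖η_∞‖)^a (1+‖x₀,∞‖)^{−k}·𝟙[η_f ∈ C_F]·𝟙[(ηx₀)_f ∈ C_E]` is summable over `E × F`: inner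
`x₀`-sum by §1 with `a := η` (cost `max(1,‖η_∞‖)^k`, `‖ι_E(η)‖ ≤ ‖ι_F(η)‖` place by place), outer `η`-sum by ★ W4 §1 + §4 over `K := F`; Mathlib `summable_prod_of_nonneg`.
§3 HEADS **`summable_differentiableOn_tsum_tsum_of_decoupled_bounds`** — for `W : ℂ → E → F → ℂ` with (hWhol) `z ↦ W z x₀ η` holomorphic on the open `U` (`η ≠ 0`) and (hWbd)
around every `z₀ ∈ U` ONE bound of the above shape and the two support clauses: (i) `∀ z ∈ U`, `Summable (p ↦ 𝟙_{η≠0}‖W z p.1 p.2‖)` on `E × F`, hence `∀ x₀, Summable (η ↦ 𝟙‖W z x₀ η‖)`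
and `Summable (x₀ ↦ Σ'_η 𝟙‖W z x₀ η‖)` (★ W1₃'s `hsumA`); (ii) around every `z₀` ONE `C` with `Σ'_{x₀} Σ'_η 𝟙‖W z x₀ η‖ ≤ C`; (iii) `z ↦ Σ'_{x₀} Σ'_η 𝟙_{η≠0} W z x₀ η` holomorphic
on `U` (★ W4 §3 Weierstrass on the product index, then `Summable.tsum_prod` as ★ W1₃ does); **`summable_continuousOn_tsum_tsum_of_decoupled_bounds`** the `ContinuousOn` twin (`𝓝[S]`).
HONEST LABEL: HC_CM is proved only modulo the 7 printed citations (2 remaining named inputs: hLiu418 = `stmt-HodgeConjecture-24832`, h413 = `stmt-HodgeConjecture-24833`) until rung 0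
closes; this file asserts no named fact, closes no socket and crosses no ceiling by itself (the arithmetic bounds are J2₃∕J3₃∕J-hJbd₃'s).
References: [MoeglinWaldspurger1995] Mœglin–Waldspurger, *Spectral Decomposition and Eisenstein Series* (1995), I.2.10, II.1.7 · [Garrett2018] Garrett, *Modern Analysis of Automorphic Forms
by Example* 1 (2018), §1.9–§1.10, §2.8 · [GelbartPS1984] Gelbart–Piatetski-Shapiro, LNM 1041 (1984), §2 (2.2.1)–(2.2.2) · [WeilBNT1967] Weil, *Basic Number Theory*, Ch. IV §2 · [Bump1997] §3.7.
-/

set_option autoImplicit false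
-- the mandated namespace repeats the single-problem summit's segment (`HodgeConjecture.HodgeConjecture`)
set_option linter.dupNamespace false

noncomputable section

open scoped NNReal Topology Classical
open NumberField NumberField.mixedEmbedding NumberField.InfinitePlace IsDedekindDomain Set Filter Module
open Summit.HodgeConjecture.HodgeConjecture.Cruxes.H413.K2E1WhittakerSeriesConvergenceU2
  (exists_exp_neg_mul_rpow_le_rpow_neg summable_majorant_ratPoints differentiableOn_tsum_of_locally_summable_norm continuousOn_tsum_of_locally_summable_norm)

namespace Summit.HodgeConjecture.HodgeConjecture.Cruxes.H413.K2E1FourierJacobiSeriesConvergenceU3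

/-! ## §1 Generic number field `K`: sup-norm letters and the dilation lemma -/

section Dilation

variable (K : Type) [Field K] [NumberField K]

/-- ★ W4's letter `‖ringEquiv_mixedSpace K (ι ξ)_∞‖` IS `‖mixedEmbedding K ξ‖` (Mathlib `InfiniteAdeleRing.mixedEmbedding_eq_algebraMap_comp`). [cite: WeilBNT1967, Ch. IV §2] -/
theorem norm_ringEquiv_mixedSpace_algebraMap (ξ : K) :
    ‖InfiniteAdeleRing.ringEquiv_mixedSpace K (algebraMap K (AdeleRing (𝓞 K) K) ξ).1‖ = ‖mixedEmbedding K ξ‖ := by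
  rw [InfiniteAdeleRing.mixedEmbedding_eq_algebraMap_comp]
  rfl

/-- Every archimedean absolute value is dominated by the sup norm: `|x|_w ≤ ‖x_∞‖` (Mathlib `normAtPlace_apply`, `norm_eq_sup'_normAtPlace`). [cite: WeilBNT1967, Ch. IV §2] -/
theorem apply_le_norm_mixedEmbedding (w : InfinitePlace K) (x : K) : w x ≤ ‖mixedEmbedding K x‖ := by
  rw [← normAtPlace_apply w x, norm_eq_sup'_normAtPlace]
  exact Finset.le_sup' (fun w => normAtPlace w (mixedEmbedding K x)) (Finset.mem_univ w)

/-- The sup norm is attained at some archimedean place: `‖x_∞‖ = |x|_{w₀}`. [cite: WeilBNT1967, Ch. IV §2] -/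
theorem exists_apply_eq_norm_mixedEmbedding (x : K) : ∃ w : InfinitePlace K, w x = ‖mixedEmbedding K x‖ := by
  obtain ⟨w, -, hw⟩ := Finset.exists_mem_eq_sup' (Finset.univ_nonempty (α := InfinitePlace K)) (fun w => normAtPlace w (mixedEmbedding K x))
  exact ⟨w, by rw [← normAtPlace_apply w x, norm_eq_sup'_normAtPlace, hw]⟩

/-- Submultiplicativity of the sup norm on `K_∞ = ℝ^{r₁} × ℂ^{r₂}`: `‖y_∞‖ ≤ ‖a_∞‖·‖(a⁻¹y)_∞‖` for `a ≠ 0`. [folklore] -/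
theorem norm_mixedEmbedding_le_mul_inv_mul {a : K} (ha : a ≠ 0) (y : K) :
    ‖mixedEmbedding K y‖ ≤ ‖mixedEmbedding K a‖ * ‖mixedEmbedding K (a⁻¹ * y)‖ := by
  conv_lhs => rw [show y = a * (a⁻¹ * y) by rw [← mul_assoc, mul_inv_cancel₀ ha, one_mul], map_mul]
  exact norm_mul_le _ _

/-- Real-variable core of the dilation step: `1 + r ≤ m·(1 + s)`, `m > 0`, `k ≥ 0` ⟹ `(1+s)^{−k} ≤ m^k·(1+r)^{−k}`. [folklore] -/
theorem one_add_rpow_neg_le_of_le_mul {r s m k : ℝ} (hr : 0 ≤ r) (hs : 0 ≤ s) (hm : 0 < m) (hk : 0 ≤ k) (hle : 1 + r ≤ m * (1 + s)) :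
    (1 + s) ^ (-k) ≤ m ^ k * (1 + r) ^ (-k) := by
  have h1s : 0 < 1 + s := by linarith
  have h1r : 0 < 1 + r := by linarith
  have hpow : (1 + r) ^ k ≤ m ^ k * (1 + s) ^ k := by
    rw [← Real.mul_rpow hm.le h1s.le]
    exact Real.rpow_le_rpow h1r.le hle hk
  have hr1 : (1 + r) ^ k * (1 + r) ^ (-k) = 1 := by rw [← Real.rpow_add h1r, add_neg_cancel, Real.rpow_zero]
  have hs1 : (1 + s) ^ k * (1 + s) ^ (-k) = 1 := by rw [← Real.rpow_add h1s, add_neg_cancel, Real.rpow_zero]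
  have hrk : 0 ≤ (1 + r) ^ (-k) := Real.rpow_nonneg h1r.le _
  have hsk : 0 ≤ (1 + s) ^ (-k) := Real.rpow_nonneg h1s.le _
  have hstep : (1 + r) ^ k * (1 + r) ^ (-k) * (1 + s) ^ (-k) ≤ (m ^ k * (1 + s) ^ k) * (1 + r) ^ (-k) * (1 + s) ^ (-k) :=
    mul_le_mul_of_nonneg_right (mul_le_mul_of_nonneg_right hpow hrk) hsk
  calc (1 + s) ^ (-k) = (1 + r) ^ k * (1 + r) ^ (-k) * (1 + s) ^ (-k) := by rw [hr1, one_mul]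
    _ ≤ (m ^ k * (1 + s) ^ k) * (1 + r) ^ (-k) * (1 + s) ^ (-k) := hstep
    _ = m ^ k * (1 + r) ^ (-k) * ((1 + s) ^ k * (1 + s) ^ (-k)) := by ring
    _ = m ^ k * (1 + r) ^ (-k) := by rw [hs1, mul_one]

/-- **The dilated decay weight**: `(1 + ‖(a⁻¹y)_∞‖)^{−k} ≤ max(1, ‖a_∞‖)^k · (1 + ‖y_∞‖)^{−k}` for `a ≠ 0`, `k ≥ 0` (from `1 + ‖y‖ ≤ max(1,‖a‖)·(1 + ‖a⁻¹y‖)`). [folklore] -/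
theorem one_add_norm_inv_mul_rpow_neg_le {a : K} (ha : a ≠ 0) (y : K) {k : ℝ} (hk : 0 ≤ k) :
    (1 + ‖mixedEmbedding K (a⁻¹ * y)‖) ^ (-k) ≤ max 1 ‖mixedEmbedding K a‖ ^ k * (1 + ‖mixedEmbedding K y‖) ^ (-k) := by
  have hs0 : 0 ≤ ‖mixedEmbedding K (a⁻¹ * y)‖ := norm_nonneg _
  have hm0 : 0 < max 1 ‖mixedEmbedding K a‖ := zero_lt_one.trans_le (le_max_left _ _)
  refine one_add_rpow_neg_le_of_le_mul (norm_nonneg _) hs0 hm0 hk ?_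
  have h1 : ‖mixedEmbedding K y‖ ≤ ‖mixedEmbedding K a‖ * ‖mixedEmbedding K (a⁻¹ * y)‖ := norm_mixedEmbedding_le_mul_inv_mul K ha y
  have h2 : ‖mixedEmbedding K a‖ * ‖mixedEmbedding K (a⁻¹ * y)‖ ≤ max 1 ‖mixedEmbedding K a‖ * ‖mixedEmbedding K (a⁻¹ * y)‖ :=
    mul_le_mul_of_nonneg_right (le_max_right _ _) hs0
  have h3 : (1 : ℝ) ≤ max 1 ‖mixedEmbedding K a‖ * 1 := by rw [mul_one]; exact le_max_left _ _
  calc 1 + ‖mixedEmbedding K y‖ ≤ max 1 ‖mixedEmbedding K a‖ * 1 + max 1 ‖mixedEmbedding K a‖ * ‖mixedEmbedding K (a⁻¹ * y)‖ := add_le_add h3 (h1.trans h2)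
    _ = max 1 ‖mixedEmbedding K a‖ * (1 + ‖mixedEmbedding K (a⁻¹ * y)‖) := by ring

/-- **THE DILATION LEMMA (J4-a).**  For `k > [K:ℚ]` and a compact `C ⊂ 𝔸_{K,f}` there is ONE `B ≥ 0` such that for EVERY `a ∈ Kˣ` the decay weight summed over the DILATED
lattice `{y ∈ K : (a·y)_f ∈ C} = a⁻¹·(K ∩ C)` satisfies `Summable` and `Σ_{y : (a·y)_f ∈ C} (1 + ‖y_∞‖)^{−k} ≤ B·max(1, ‖a_∞‖)^k` (reindex `y' = a·y`, §1's dilated weight, ★ W4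
`summable_majorant_ratPoints`).  The `x₀`-sum of the Fourier–Jacobi layer at central frequency `η` is of this shape with `a = η`. [cite: WeilBNT1967, Ch. IV §2] [cite: Garrett2018, §1.9] -/
theorem exists_forall_tsum_rpow_neg_dilate_le {k : ℕ} (hk : finrank ℚ K < k) {C : Set (FiniteAdeleRing (𝓞 K) K)} (hC : IsCompact C) :
    ∃ B : ℝ, 0 ≤ B ∧ ∀ a : K, a ≠ 0 →
      Summable (fun y : K => if (algebraMap K (AdeleRing (𝓞 K) K) (a * y)).2 ∈ C then (1 + ‖mixedEmbedding K y‖) ^ (-(k : ℝ)) else 0) ∧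
      (∀ y : K, 0 ≤ (if (algebraMap K (AdeleRing (𝓞 K) K) (a * y)).2 ∈ C then (1 + ‖mixedEmbedding K y‖) ^ (-(k : ℝ)) else 0)) ∧
      ∑' y : K, (if (algebraMap K (AdeleRing (𝓞 K) K) (a * y)).2 ∈ C then (1 + ‖mixedEmbedding K y‖) ^ (-(k : ℝ)) else 0) ≤
        B * max 1 ‖mixedEmbedding K a‖ ^ (k : ℝ) := by
  -- ★ W4's summable majorant `u₀(ξ) = 𝟙[ξ_f ∈ C]·(1+‖ξ_∞‖)^{−k}` (with `M = 1`), rewritten in `mixedEmbedding` letters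
  obtain ⟨hu₀, hu₀0⟩ := summable_majorant_ratPoints K hk zero_le_one hC
  set u₀ : K → ℝ := fun ξ => if (algebraMap K (AdeleRing (𝓞 K) K) ξ).2 ∈ C then (1 + ‖mixedEmbedding K ξ‖) ^ (-(k : ℝ)) else 0 with hu₀def
  have hu₀eq : (fun ξ : K => if (algebraMap K (AdeleRing (𝓞 K) K) ξ).2 ∈ C then 1 * (1 + ‖InfiniteAdeleRing.ringEquiv_mixedSpace K (algebraMap K (AdeleRing (𝓞 K) K) ξ).1‖) ^ (-(k : ℝ)) else 0) = u₀ := by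
    funext ξ
    rw [hu₀def, norm_ringEquiv_mixedSpace_algebraMap, one_mul]
  rw [hu₀eq] at hu₀
  have hu₀nn : ∀ ξ, 0 ≤ u₀ ξ := fun ξ => by
    have h := hu₀0 ξ
    rwa [norm_ringEquiv_mixedSpace_algebraMap, one_mul] at h
  refine ⟨∑' ξ, u₀ ξ, tsum_nonneg hu₀nn, fun a ha => ?_⟩
  have hk0 : (0 : ℝ) ≤ (k : ℝ) := Nat.cast_nonneg k
  set m : ℝ := max 1 ‖mixedEmbedding K a‖ ^ (k : ℝ) with hm
  have hm0 : 0 ≤ m := Real.rpow_nonneg (zero_le_one.trans (le_max_left _ _)) _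
  -- the reindexed majorant `y ↦ u₀(a·y)` is summable with the same sum
  set e : K ≃ K := Equiv.mulLeft₀ a ha with he
  have hsum_re : Summable (fun y : K => u₀ (a * y)) := (e.summable_iff (f := u₀)).2 hu₀
  have htsum_re : ∑' y : K, u₀ (a * y) = ∑' ξ, u₀ ξ := e.tsum_eq u₀
  -- termwise domination
  have hdom : ∀ y : K, (if (algebraMap K (AdeleRing (𝓞 K) K) (a * y)).2 ∈ C then (1 + ‖mixedEmbedding K y‖) ^ (-(k : ℝ)) else 0) ≤ m * u₀ (a * y) := by
    intro y
    by_cases hy : (algebraMap K (AdeleRing (𝓞 K) K) (a * y)).2 ∈ C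
    · rw [if_pos hy, hu₀def]
      dsimp only
      rw [if_pos hy]
      have h := one_add_norm_inv_mul_rpow_neg_le K ha (a * y) hk0
      rwa [← mul_assoc, inv_mul_cancel₀ ha, one_mul] at h
    · rw [if_neg hy]
      exact mul_nonneg hm0 (hu₀nn _)
  have hnn : ∀ y : K, 0 ≤ (if (algebraMap K (AdeleRing (𝓞 K) K) (a * y)).2 ∈ C then (1 + ‖mixedEmbedding K y‖) ^ (-(k : ℝ)) else 0) := fun y => by
    split_ifs; exacts [Real.rpow_nonneg (by positivity) _, le_rfl]
  have hsum : Summable (fun y : K => if (algebraMap K (AdeleRing (𝓞 K) K) (a * y)).2 ∈ C then (1 + ‖mixedEmbedding K y‖) ^ (-(k : ℝ)) else 0) :=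
    Summable.of_nonneg_of_le hnn hdom (hsum_re.mul_left m)
  refine ⟨hsum, hnn, ?_⟩
  calc ∑' y : K, (if (algebraMap K (AdeleRing (𝓞 K) K) (a * y)).2 ∈ C then (1 + ‖mixedEmbedding K y‖) ^ (-(k : ℝ)) else 0)
      ≤ ∑' y : K, m * u₀ (a * y) := hsum.tsum_le_tsum hdom (hsum_re.mul_left m)
    _ = m * ∑' ξ, u₀ ξ := by rw [tsum_mul_left, htsum_re]
    _ = (∑' ξ, u₀ ξ) * max 1 ‖mixedEmbedding K a‖ ^ (k : ℝ) := by rw [hm, mul_comm]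

end Dilation

/-! ## §2 Two number fields `F ⊂ E`: the two-index majorant over `E × F` -/

section TwoIndex

variable (F E : Type) [Field F] [NumberField F] [Field E] [NumberField E] [Algebra F E]

omit [NumberField E] in
/-- `|η|_w ≤ ‖η_∞‖_F` for every archimedean place `w` of `E` and `η ∈ F` (`w|_F` is an archimedean place of `F`, Mathlib `InfinitePlace.comap_apply`). [cite: WeilBNT1967, Ch. IV §2] -/
theorem apply_algebraMap_le_norm_mixedEmbedding (w : InfinitePlace E) (η : F) : w (algebraMap F E η) ≤ ‖mixedEmbedding F η‖ := by
  rw [← comap_apply w (algebraMap F E) η]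
  exact apply_le_norm_mixedEmbedding F _ η

/-- The easy comparison of sup norms along `F ⊂ E`: `‖ι_E(η)_∞‖ ≤ ‖ι_F(η)_∞‖`. [cite: WeilBNT1967, Ch. IV §2] -/
theorem norm_mixedEmbedding_algebraMap_le (η : F) : ‖mixedEmbedding E (algebraMap F E η)‖ ≤ ‖mixedEmbedding F η‖ := by
  obtain ⟨w, hw⟩ := exists_apply_eq_norm_mixedEmbedding E (algebraMap F E η)
  rw [← hw]
  exact apply_algebraMap_le_norm_mixedEmbedding F E w η

/-- **THE TWO-INDEX MAJORANT IS SUMMABLE OVER `E × F`.**  For `k > [E:ℚ]`, `M ≥ 0`, `b > 0`, any real `a`, and compact `C_F ⊂ 𝔸_{F,f}`, `C_E ⊂ 𝔸_{E,f}`, the function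
`u(x₀, η) := 𝟙[η ≠ 0, η_f ∈ C_F, (η·x₀)_f ∈ C_E] · M·e^{−b‖η_∞‖}·(1+‖η_∞‖)^a·(1+‖x₀,∞‖)^{−k}` is non-negative and summable on `E × F`: the `x₀`-sum at fixed `η ≠ 0` is §1's dilated
sum (`≤ B·max(1,‖ι_E(η)_∞‖)^k ≤ B·(1+‖η_∞‖)^k`), and `η ↦ 𝟙[η_f ∈ C_F]·M B e^{−b‖η_∞‖}(1+‖η_∞‖)^{a+k} ≤ 𝟙[η_f ∈ C_F]·M B M'·(1+‖η_∞‖)^{−[F:ℚ]−1}` is ★ W4's summable majorant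
over `K := F` (Mathlib `summable_prod_of_nonneg`). [cite: MoeglinWaldspurger1995, I.2.10] [cite: Garrett2018, §1.9–§1.10] -/
theorem summable_twoIndexMajorant {k : ℕ} (hk : finrank ℚ E < k) {M b : ℝ} (hM0 : 0 ≤ M) (hb : 0 < b) (a : ℝ)
    {CF : Set (FiniteAdeleRing (𝓞 F) F)} (hCF : IsCompact CF) {CE : Set (FiniteAdeleRing (𝓞 E) E)} (hCE : IsCompact CE) :
    Summable (fun p : E × F =>
      if p.2 ≠ 0 ∧ (algebraMap F (AdeleRing (𝓞 F) F) p.2).2 ∈ CF ∧ (algebraMap E (AdeleRing (𝓞 E) E) (algebraMap F E p.2 * p.1)).2 ∈ CE then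
        M * Real.exp (-(b * ‖mixedEmbedding F p.2‖)) * (1 + ‖mixedEmbedding F p.2‖) ^ a * (1 + ‖mixedEmbedding E p.1‖) ^ (-(k : ℝ)) else 0) ∧
    ∀ p : E × F, 0 ≤ (if p.2 ≠ 0 ∧ (algebraMap F (AdeleRing (𝓞 F) F) p.2).2 ∈ CF ∧ (algebraMap E (AdeleRing (𝓞 E) E) (algebraMap F E p.2 * p.1)).2 ∈ CE then
        M * Real.exp (-(b * ‖mixedEmbedding F p.2‖)) * (1 + ‖mixedEmbedding F p.2‖) ^ a * (1 + ‖mixedEmbedding E p.1‖) ^ (-(k : ℝ)) else 0) := by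
  -- the two factors: `A η` (the `η`-weight with its support) and `D η x₀` (the dilated `x₀`-weight)
  set A : F → ℝ := fun η => if η ≠ 0 ∧ (algebraMap F (AdeleRing (𝓞 F) F) η).2 ∈ CF then
    M * Real.exp (-(b * ‖mixedEmbedding F η‖)) * (1 + ‖mixedEmbedding F η‖) ^ a else 0 with hA
  set D : F → E → ℝ := fun η x₀ => if (algebraMap E (AdeleRing (𝓞 E) E) (algebraMap F E η * x₀)).2 ∈ CE then (1 + ‖mixedEmbedding E x₀‖) ^ (-(k : ℝ)) else 0 with hD
  have hApos : ∀ η, 0 ≤ M * Real.exp (-(b * ‖mixedEmbedding F η‖)) * (1 + ‖mixedEmbedding F η‖) ^ a := fun η =>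
    mul_nonneg (mul_nonneg hM0 (Real.exp_nonneg _)) (Real.rpow_nonneg (by positivity) _)
  have hA0 : ∀ η, 0 ≤ A η := fun η => by rw [hA]; dsimp only; split_ifs; exacts [hApos η, le_rfl]
  have hD0 : ∀ η x₀, 0 ≤ D η x₀ := fun η x₀ => by rw [hD]; dsimp only; split_ifs; exacts [Real.rpow_nonneg (by positivity) _, le_rfl]
  have hsplit : ∀ (x₀ : E) (η : F), (if η ≠ 0 ∧ (algebraMap F (AdeleRing (𝓞 F) F) η).2 ∈ CF ∧ (algebraMap E (AdeleRing (𝓞 E) E) (algebraMap F E η * x₀)).2 ∈ CE then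
        M * Real.exp (-(b * ‖mixedEmbedding F η‖)) * (1 + ‖mixedEmbedding F η‖) ^ a * (1 + ‖mixedEmbedding E x₀‖) ^ (-(k : ℝ)) else 0) = A η * D η x₀ := by
    intro x₀ η
    rw [hA, hD]
    dsimp only
    by_cases h1 : η ≠ 0 ∧ (algebraMap F (AdeleRing (𝓞 F) F) η).2 ∈ CF
    · by_cases h2 : (algebraMap E (AdeleRing (𝓞 E) E) (algebraMap F E η * x₀)).2 ∈ CE
      · rw [if_pos ⟨h1.1, h1.2, h2⟩, if_pos h1, if_pos h2]
      · rw [if_neg (fun h => h2 h.2.2), if_neg h2, mul_zero]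
    · rw [if_neg (fun h => h1 ⟨h.1, h.2.1⟩), if_neg h1, zero_mul]
  have hnn : ∀ p : E × F, 0 ≤ (if p.2 ≠ 0 ∧ (algebraMap F (AdeleRing (𝓞 F) F) p.2).2 ∈ CF ∧ (algebraMap E (AdeleRing (𝓞 E) E) (algebraMap F E p.2 * p.1)).2 ∈ CE then
        M * Real.exp (-(b * ‖mixedEmbedding F p.2‖)) * (1 + ‖mixedEmbedding F p.2‖) ^ a * (1 + ‖mixedEmbedding E p.1‖) ^ (-(k : ℝ)) else 0) := fun p => by
    rw [hsplit p.1 p.2]; exact mul_nonneg (hA0 _) (hD0 _ _)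
  refine ⟨?_, hnn⟩
  -- §1 over `K := E`: ONE `B` for all dilations
  obtain ⟨B, hB0, hB⟩ := exists_forall_tsum_rpow_neg_dilate_le E hk hCE
  have hk0 : (0 : ℝ) ≤ (k : ℝ) := Nat.cast_nonneg k
  -- (α) the `x₀`-sums at fixed `η`
  have hα : ∀ η : F, Summable (fun x₀ : E => A η * D η x₀) := by
    intro η
    by_cases hη : η = 0
    · have hA00 : A η = 0 := by rw [hA]; dsimp only; rw [if_neg (fun h => h.1 hη)]
      simp only [hA00, zero_mul]
      exact summable_zero
    · exact (hB (algebraMap F E η) ((map_ne_zero (algebraMap F E)).2 hη)).1.mul_left (A η)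
  have hαle : ∀ η : F, η ≠ 0 → ∑' x₀ : E, D η x₀ ≤ B * max 1 ‖mixedEmbedding E (algebraMap F E η)‖ ^ (k : ℝ) := fun η hη =>
    (hB (algebraMap F E η) ((map_ne_zero (algebraMap F E)).2 hη)).2.2
  -- (β) the `η`-sum of the `x₀`-sums: dominated by ★ W4's majorant over `K := F`
  obtain ⟨M', hM'0, hM'⟩ := exists_exp_neg_mul_rpow_le_rpow_neg hb (a + k) ((finrank ℚ F + 1 : ℕ) : ℝ)
  obtain ⟨hv, -⟩ := summable_majorant_ratPoints F (Nat.lt_succ_self (finrank ℚ F)) (M := M * B * M') (by positivity) hCF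
  have hβle : ∀ η : F, ∑' x₀ : E, A η * D η x₀ ≤
      (if (algebraMap F (AdeleRing (𝓞 F) F) η).2 ∈ CF then M * B * M' * (1 + ‖InfiniteAdeleRing.ringEquiv_mixedSpace F (algebraMap F (AdeleRing (𝓞 F) F) η).1‖) ^ (-((finrank ℚ F + 1 : ℕ) : ℝ)) else 0) := by
    intro η
    rw [norm_ringEquiv_mixedSpace_algebraMap]
    by_cases h1 : η ≠ 0 ∧ (algebraMap F (AdeleRing (𝓞 F) F) η).2 ∈ CF
    · rw [if_pos h1.2, tsum_mul_left]
      set R : ℝ := ‖mixedEmbedding F η‖ with hR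
      have hR0 : 0 ≤ R := norm_nonneg _
      have hAη : A η = M * Real.exp (-(b * R)) * (1 + R) ^ a := by rw [hA]; dsimp only; rw [if_pos h1]
      have hmax : max 1 ‖mixedEmbedding E (algebraMap F E η)‖ ^ (k : ℝ) ≤ (1 + R) ^ (k : ℝ) := by
        refine Real.rpow_le_rpow (zero_le_one.trans (le_max_left _ _)) (max_le (by linarith) ?_) hk0
        exact (norm_mixedEmbedding_algebraMap_le F E η).trans (by linarith)
      have h2 : ∑' x₀ : E, D η x₀ ≤ B * (1 + R) ^ (k : ℝ) := (hαle η h1.1).trans (mul_le_mul_of_nonneg_left hmax hB0)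
      have h3 := hM' R hR0
      have h1R : 0 < 1 + R := by linarith
      calc A η * ∑' x₀ : E, D η x₀ ≤ A η * (B * (1 + R) ^ (k : ℝ)) := mul_le_mul_of_nonneg_left h2 (hA0 η)
        _ = M * B * (Real.exp (-(b * R)) * ((1 + R) ^ a * (1 + R) ^ (k : ℝ))) := by rw [hAη]; ring
        _ = M * B * (Real.exp (-(b * R)) * (1 + R) ^ (a + k)) := by rw [← Real.rpow_add h1R]
        _ ≤ M * B * (M' * (1 + R) ^ (-((finrank ℚ F + 1 : ℕ) : ℝ))) := mul_le_mul_of_nonneg_left h3 (mul_nonneg hM0 hB0)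
        _ = M * B * M' * (1 + R) ^ (-((finrank ℚ F + 1 : ℕ) : ℝ)) := by ring
    · have hA00 : A η = 0 := by rw [hA]; dsimp only; rw [if_neg h1]
      simp only [hA00, zero_mul, tsum_zero]
      split_ifs; exacts [mul_nonneg (by positivity) (Real.rpow_nonneg (by positivity) _), le_rfl]
  have hβ : Summable (fun η : F => ∑' x₀ : E, A η * D η x₀) :=
    Summable.of_nonneg_of_le (fun η => tsum_nonneg fun x₀ => mul_nonneg (hA0 η) (hD0 η x₀)) hβle hv
  -- assemble on `F × E`, then swap to `E × F`
  have hFE : Summable (fun q : F × E => A q.1 * D q.1 q.2) :=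
    (summable_prod_of_nonneg (fun q => mul_nonneg (hA0 q.1) (hD0 q.1 q.2))).2 ⟨hα, hβ⟩
  have hswap : (fun p : E × F => if p.2 ≠ 0 ∧ (algebraMap F (AdeleRing (𝓞 F) F) p.2).2 ∈ CF ∧ (algebraMap E (AdeleRing (𝓞 E) E) (algebraMap F E p.2 * p.1)).2 ∈ CE then
        M * Real.exp (-(b * ‖mixedEmbedding F p.2‖)) * (1 + ‖mixedEmbedding F p.2‖) ^ a * (1 + ‖mixedEmbedding E p.1‖) ^ (-(k : ℝ)) else 0) =
      (fun q : F × E => A q.1 * D q.1 q.2) ∘ (Equiv.prodComm E F) := by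
    funext p
    simp only [Function.comp_apply, Equiv.prodComm_apply, Prod.swap]
    exact hsplit p.1 p.2
  rw [hswap]
  exact (Equiv.summable_iff (Equiv.prodComm E F)).2 hFE

/-- **The decoupled bound feeds the majorant**: on a set `V` of parameters where ONE decoupled bound and the two support clauses hold, §2's `u` dominates both
`𝟙_{η≠0}‖W z x₀ η‖` and `‖𝟙_{η≠0}·W z x₀ η‖` for every `z ∈ V`. [cite: Garrett2018, §1.9–§1.10] -/
theorem exists_summable_majorant_of_decoupled_bound {V : Set ℂ} {W : ℂ → E → F → ℂ} {M b a : ℝ} {k : ℕ} (hM0 : 0 ≤ M) (hb : 0 < b) (hk : finrank ℚ E < k)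
    {CF : Set (FiniteAdeleRing (𝓞 F) F)} (hCF : IsCompact CF) {CE : Set (FiniteAdeleRing (𝓞 E) E)} (hCE : IsCompact CE)
    (hbd : ∀ z ∈ V, ∀ (x₀ : E) (η : F), η ≠ 0 →
        ‖W z x₀ η‖ ≤ M * Real.exp (-(b * ‖mixedEmbedding F η‖)) * (1 + ‖mixedEmbedding F η‖) ^ a * (1 + ‖mixedEmbedding E x₀‖) ^ (-(k : ℝ)) ∧
        ((algebraMap F (AdeleRing (𝓞 F) F) η).2 ∉ CF → W z x₀ η = 0) ∧
        ((algebraMap E (AdeleRing (𝓞 E) E) (algebraMap F E η * x₀)).2 ∉ CE → W z x₀ η = 0)) :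
    ∃ u : E × F → ℝ, Summable u ∧ (∀ z ∈ V, ∀ p : E × F, ({0}ᶜ : Set F).indicator (fun η => ‖W z p.1 η‖) p.2 ≤ u p) ∧
      ∀ z ∈ V, ∀ p : E × F, ‖({0}ᶜ : Set F).indicator (W z p.1) p.2‖ ≤ u p := by
  obtain ⟨hu, hu0⟩ := summable_twoIndexMajorant F E hk hM0 hb a hCF hCE
  have hdom : ∀ z ∈ V, ∀ p : E × F, ({0}ᶜ : Set F).indicator (fun η => ‖W z p.1 η‖) p.2 ≤
      (if p.2 ≠ 0 ∧ (algebraMap F (AdeleRing (𝓞 F) F) p.2).2 ∈ CF ∧ (algebraMap E (AdeleRing (𝓞 E) E) (algebraMap F E p.2 * p.1)).2 ∈ CE then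
        M * Real.exp (-(b * ‖mixedEmbedding F p.2‖)) * (1 + ‖mixedEmbedding F p.2‖) ^ a * (1 + ‖mixedEmbedding E p.1‖) ^ (-(k : ℝ)) else 0) := by
    intro z hz p
    by_cases hη : p.2 = 0
    · rw [Set.indicator_of_notMem (show p.2 ∉ ({0}ᶜ : Set F) from fun h => h hη)]
      exact hu0 p
    · rw [Set.indicator_of_mem (show p.2 ∈ ({0}ᶜ : Set F) from hη)]
      obtain ⟨hle, hsF, hsE⟩ := hbd z hz p.1 p.2 hη
      by_cases hF : (algebraMap F (AdeleRing (𝓞 F) F) p.2).2 ∈ CF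
      · by_cases hEm : (algebraMap E (AdeleRing (𝓞 E) E) (algebraMap F E p.2 * p.1)).2 ∈ CE
        · rw [if_pos ⟨hη, hF, hEm⟩]; exact hle
        · rw [hsE hEm, norm_zero]; exact hu0 p
      · rw [hsF hF, norm_zero]; exact hu0 p
  refine ⟨_, hu, hdom, fun z hz p => ?_⟩
  rw [norm_indicator_eq_indicator_norm]
  exact hdom z hz p

/-! ## §3 The heads: the iterated Fourier–Jacobi sum `Σ'_{x₀ ∈ E} Σ'_{η ∈ F} 𝟙_{η≠0} W z x₀ η` (DECOUPLED currency) -/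

/-- **J4₃ ENGINE, DECOUPLED CURRENCY.**  Let `U ⊆ ℂ` be open and `W : ℂ → E → F → ℂ` (the Fourier–Jacobi coefficient `𝓕_F[Φ_{g,z}(x₀,·)](η)` of ★ W1₃ as a function of `(z, x₀, η)`) with
(hWhol) `z ↦ W z x₀ η` holomorphic on `U` for every `x₀ ∈ E`, `η ∈ Fˣ`, and (hWbd) around every `z₀ ∈ U` a neighbourhood `V` with ONE bound
`‖W z x₀ η‖ ≤ M·e^{−b‖η_∞‖}·(1+‖η_∞‖)^a·(1+‖x₀,∞‖)^{−k}` (`M ≥ 0`, `b > 0`, `a ∈ ℝ`, `k > [E:ℚ]`; sup norms of the mixed embeddings) and TWO compact supports: `W z x₀ η = 0` unless `η_f ∈ C_F`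
and unless `(η·x₀)_f ∈ C_E`.  Then: (i) for every `z ∈ U` the family `(x₀, η) ↦ 𝟙_{η≠0}‖W z x₀ η‖` is summable on `E × F`, (i′) so is `η ↦ 𝟙_{η≠0}‖W z x₀ η‖` for every `x₀`, and
(i″) `x₀ ↦ Σ'_η 𝟙_{η≠0}‖W z x₀ η‖` (★ W1₃'s letter `hsumA`); (ii) around every `z₀ ∈ U` ONE `C` with `Σ'_{x₀} Σ'_η 𝟙_{η≠0}‖W z x₀ η‖ ≤ C` (locally uniform convergence); (iii)
`z ↦ Σ'_{x₀} Σ'_η 𝟙_{η≠0}·W z x₀ η` is holomorphic on `U`. [cite: MoeglinWaldspurger1995, I.2.10 and II.1.7] [cite: Garrett2018, §1.9–§1.10 and §2.8] [cite: GelbartPS1984, §2 (2.2.1)–(2.2.2)] -/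
theorem summable_differentiableOn_tsum_tsum_of_decoupled_bounds {U : Set ℂ} (hU : IsOpen U) {W : ℂ → E → F → ℂ}
    (hWhol : ∀ (x₀ : E) (η : F), η ≠ 0 → DifferentiableOn ℂ (fun z => W z x₀ η) U)
    (hWbd : ∀ z₀ ∈ U, ∃ V ∈ 𝓝 z₀, ∃ (M b a : ℝ) (k : ℕ) (CF : Set (FiniteAdeleRing (𝓞 F) F)) (CE : Set (FiniteAdeleRing (𝓞 E) E)),
      0 ≤ M ∧ 0 < b ∧ finrank ℚ E < k ∧ IsCompact CF ∧ IsCompact CE ∧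
      ∀ z ∈ V, ∀ (x₀ : E) (η : F), η ≠ 0 →
        ‖W z x₀ η‖ ≤ M * Real.exp (-(b * ‖mixedEmbedding F η‖)) * (1 + ‖mixedEmbedding F η‖) ^ a * (1 + ‖mixedEmbedding E x₀‖) ^ (-(k : ℝ)) ∧
        ((algebraMap F (AdeleRing (𝓞 F) F) η).2 ∉ CF → W z x₀ η = 0) ∧
        ((algebraMap E (AdeleRing (𝓞 E) E) (algebraMap F E η * x₀)).2 ∉ CE → W z x₀ η = 0)) :
    (∀ z ∈ U, Summable fun p : E × F => ({0}ᶜ : Set F).indicator (fun η => ‖W z p.1 η‖) p.2) ∧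
    (∀ z ∈ U, ∀ x₀ : E, Summable fun η : F => ({0}ᶜ : Set F).indicator (fun η => ‖W z x₀ η‖) η) ∧
    (∀ z ∈ U, Summable fun x₀ : E => ∑' η : F, ({0}ᶜ : Set F).indicator (fun η => ‖W z x₀ η‖) η) ∧
    (∀ z₀ ∈ U, ∃ V ∈ 𝓝 z₀, ∃ C : ℝ, ∀ z ∈ V, ∑' x₀ : E, ∑' η : F, ({0}ᶜ : Set F).indicator (fun η => ‖W z x₀ η‖) η ≤ C) ∧
    DifferentiableOn ℂ (fun z => ∑' x₀ : E, ∑' η : F, ({0}ᶜ : Set F).indicator (W z x₀) η) U := by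
  -- around every `z₀`: §2's summable majorant dominates both indicator families on the neighbourhood
  have key : ∀ z₀ ∈ U, ∃ V ∈ 𝓝 z₀, ∃ u : E × F → ℝ, Summable u ∧
      (∀ z ∈ V, ∀ p : E × F, ({0}ᶜ : Set F).indicator (fun η => ‖W z p.1 η‖) p.2 ≤ u p) ∧
      ∀ z ∈ V, ∀ p : E × F, ‖({0}ᶜ : Set F).indicator (W z p.1) p.2‖ ≤ u p := by
    intro z₀ hz₀
    obtain ⟨V, hV, M, b, a, k, CF, CE, hM0, hb, hk, hCF, hCE, hbd⟩ := hWbd z₀ hz₀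
    exact ⟨V, hV, exists_summable_majorant_of_decoupled_bound F E hM0 hb hk hCF hCE hbd⟩
  -- (i) product summability on `U`
  have hP : ∀ z ∈ U, Summable fun p : E × F => ({0}ᶜ : Set F).indicator (fun η => ‖W z p.1 η‖) p.2 := fun z hz => by
    obtain ⟨V, hV, u, hu, hdom, -⟩ := key z hz
    exact Summable.of_nonneg_of_le (fun p => Set.indicator_nonneg (fun _ _ => norm_nonneg _) _) (hdom z (mem_of_mem_nhds hV)) hu
  refine ⟨hP, fun z hz x₀ => (hP z hz).prod_factor x₀, fun z hz => (hP z hz).prod, fun z₀ hz₀ => ?_, ?_⟩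
  · -- (ii) the locally uniform bound `Σ' u`
    obtain ⟨V, hV, u, hu, hdom, -⟩ := key z₀ hz₀
    refine ⟨V, hV, ∑' p, u p, fun z hz => ?_⟩
    have hs : Summable fun p : E × F => ({0}ᶜ : Set F).indicator (fun η => ‖W z p.1 η‖) p.2 :=
      Summable.of_nonneg_of_le (fun p => Set.indicator_nonneg (fun _ _ => norm_nonneg _) _) (hdom z hz) hu
    rw [← hs.tsum_prod]
    exact hs.tsum_le_tsum (hdom z hz) hu
  · -- (iii) holomorphy: Weierstrass on the product index (★ W4 §3), then the iterated sum is the product sum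
    have hG : DifferentiableOn ℂ (fun z => ∑' p : E × F, ({0}ᶜ : Set F).indicator (W z p.1) p.2) U := by
      refine differentiableOn_tsum_of_locally_summable_norm hU (fun p => ?_) (fun z₀ hz₀ => ?_)
      · by_cases hη : p.2 = 0
        · simp only [Set.mem_compl_iff, Set.mem_singleton_iff, hη, not_true_eq_false, not_false_eq_true, Set.indicator_of_notMem]
          exact differentiableOn_const 0
        · simp only [Set.mem_compl_iff, Set.mem_singleton_iff, hη, not_false_eq_true, Set.indicator_of_mem]
          exact hWhol p.1 p.2 hη
      · obtain ⟨V, hV, u, hu, -, hdom'⟩ := key z₀ hz₀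
        exact ⟨V, hV, u, hu, fun p w hw => hdom' w hw p⟩
    refine hG.congr fun z hz => ?_
    obtain ⟨V, hV, u, hu, -, hdom'⟩ := key z hz
    have hs : Summable fun p : E × F => ({0}ᶜ : Set F).indicator (W z p.1) p.2 :=
      Summable.of_norm (Summable.of_nonneg_of_le (fun _ => norm_nonneg _) (hdom' z (mem_of_mem_nhds hV)) hu)
    exact hs.tsum_prod.symm

/-- **J4₃ ENGINE, CONTINUITY UP TO THE EDGE** (for «continuous on `Re z ≥ 1`»-type clauses): on an arbitrary `S ⊆ ℂ`, if every `z ↦ W z x₀ η` (`η ≠ 0`) is continuous on `S` and around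
every `z₀ ∈ S` a neighbourhood WITHIN `S` carries ONE decoupled bound with the two compact supports, then for every `z ∈ S` the family `(x₀,η) ↦ 𝟙_{η≠0}‖W z x₀ η‖` is summable
on `E × F` and `z ↦ Σ'_{x₀} Σ'_η 𝟙_{η≠0} W z x₀ η` is continuous on `S`. [cite: Garrett2018, §1.9–§1.10] [cite: Bump1997, §3.7] -/
theorem summable_continuousOn_tsum_tsum_of_decoupled_bounds {S : Set ℂ} {W : ℂ → E → F → ℂ}
    (hWcont : ∀ (x₀ : E) (η : F), η ≠ 0 → ContinuousOn (fun z => W z x₀ η) S)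
    (hWbd : ∀ z₀ ∈ S, ∃ V ∈ 𝓝[S] z₀, ∃ (M b a : ℝ) (k : ℕ) (CF : Set (FiniteAdeleRing (𝓞 F) F)) (CE : Set (FiniteAdeleRing (𝓞 E) E)),
      0 ≤ M ∧ 0 < b ∧ finrank ℚ E < k ∧ IsCompact CF ∧ IsCompact CE ∧
      ∀ z ∈ V, ∀ (x₀ : E) (η : F), η ≠ 0 →
        ‖W z x₀ η‖ ≤ M * Real.exp (-(b * ‖mixedEmbedding F η‖)) * (1 + ‖mixedEmbedding F η‖) ^ a * (1 + ‖mixedEmbedding E x₀‖) ^ (-(k : ℝ)) ∧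
        ((algebraMap F (AdeleRing (𝓞 F) F) η).2 ∉ CF → W z x₀ η = 0) ∧
        ((algebraMap E (AdeleRing (𝓞 E) E) (algebraMap F E η * x₀)).2 ∉ CE → W z x₀ η = 0)) :
    (∀ z ∈ S, Summable fun p : E × F => ({0}ᶜ : Set F).indicator (fun η => ‖W z p.1 η‖) p.2) ∧
    ContinuousOn (fun z => ∑' x₀ : E, ∑' η : F, ({0}ᶜ : Set F).indicator (W z x₀) η) S := by
  have key : ∀ z₀ ∈ S, ∃ V ∈ 𝓝[S] z₀, ∃ u : E × F → ℝ, Summable u ∧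
      (∀ z ∈ V, ∀ p : E × F, ({0}ᶜ : Set F).indicator (fun η => ‖W z p.1 η‖) p.2 ≤ u p) ∧
      ∀ z ∈ V, ∀ p : E × F, ‖({0}ᶜ : Set F).indicator (W z p.1) p.2‖ ≤ u p := by
    intro z₀ hz₀
    obtain ⟨V, hV, M, b, a, k, CF, CE, hM0, hb, hk, hCF, hCE, hbd⟩ := hWbd z₀ hz₀
    exact ⟨V, hV, exists_summable_majorant_of_decoupled_bound F E hM0 hb hk hCF hCE hbd⟩
  have hP : ∀ z ∈ S, Summable fun p : E × F => ({0}ᶜ : Set F).indicator (fun η => ‖W z p.1 η‖) p.2 := fun z hz => by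
    obtain ⟨V, hV, u, hu, hdom, -⟩ := key z hz
    exact Summable.of_nonneg_of_le (fun p => Set.indicator_nonneg (fun _ _ => norm_nonneg _) _) (hdom z (mem_of_mem_nhdsWithin hz hV)) hu
  refine ⟨hP, ?_⟩
  have hG : ContinuousOn (fun z => ∑' p : E × F, ({0}ᶜ : Set F).indicator (W z p.1) p.2) S := by
    refine continuousOn_tsum_of_locally_summable_norm (fun p => ?_) (fun z₀ hz₀ => ?_)
    · by_cases hη : p.2 = 0
      · simp only [Set.mem_compl_iff, Set.mem_singleton_iff, hη, not_true_eq_false, not_false_eq_true, Set.indicator_of_notMem]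
        exact continuousOn_const
      · simp only [Set.mem_compl_iff, Set.mem_singleton_iff, hη, not_false_eq_true, Set.indicator_of_mem]
        exact hWcont p.1 p.2 hη
    · obtain ⟨V, hV, u, hu, -, hdom'⟩ := key z₀ hz₀
      exact ⟨V, hV, u, hu, fun p w hw => hdom' w hw p⟩
  refine hG.congr fun z hz => ?_
  obtain ⟨V, hV, u, hu, -, hdom'⟩ := key z hz
  have hs : Summable fun p : E × F => ({0}ᶜ : Set F).indicator (W z p.1) p.2 :=
    Summable.of_norm (Summable.of_nonneg_of_le (fun _ => norm_nonneg _) (hdom' z (mem_of_mem_nhdsWithin hz hV)) hu)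
  exact hs.tsum_prod.symm

end TwoIndex

end Summit.HodgeConjecture.HodgeConjecture.Cruxes.H413.K2E1FourierJacobiSeriesConvergenceU3

end
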